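import Summits.ResolutionOfSingularities.ResolutionOfSingularities.Theorems.DeltaCutNerve

/-!
# DeltaCutNerveRound — lens-6 g31 node «NerveCut», part 2/3: THE CROSSING-FIRST ROUND ON LABEL STRINGS (Theorem B)

`SRound.sRound n` = the tree's two-step singular hop `sHop` read on a normal-crossings chain of monomial planes
`(x², …uᵃvᵇ…)` (step 1: every crossing of alive neighbours `a, b` gives a newborn plane of label `a + b − n`; step 2: every
old plane drops by `n`); invariants `LiveEdge` (`≥ 2n, ≥ n` adjacent: never `BadEmpty`) and `HeavyEdge` (`≥ 3n, ≥ 2n`: the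
maximum label grows by `≥ n` per round); `no_termination_measure`: no map to any well-founded order drops along a round on
every live string (the «P‴ invariant WHOLE» door is closed for cause); the D₀ rows `[6,6] → [4,10,4] → [2,12,8,12,2] → …`
(= HOME `g30/frame/CN37.md`) and the periodic orbit `[4,2] ↔ [2,4]` of D₁ = `(x², z⁴w²)`.  0 sorry, `decide` only.
-/

noncomputable section

open CategoryTheory CategoryTheory.Limits AlgebraicGeometry TopologicalSpace IsLocalRing
open Literature.AlgebraicGeometry.Resolution

namespace Summit.ResolutionOfSingularities.ResolutionOfSingularities.Theorems.DeltaCutClasses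

/-! ## §B THE CROSSING-FIRST LAW ON A STRING OF LABELS: perpetual growth (the barrier, combinatorial half) -/

section CrossingRound

namespace SRound

/-- **ONE ROUND OF THE CROSSING-FIRST LAW ON A STRING OF LABELS.**  The dual complex of the bad locus of the data
`(x², ∏ uᵢ^{aᵢ})` met in §C is a PATH: consecutive components cross along a regular curve, a component is ALIVE (inside the
order-`n` locus of the monomial) iff its label is `≥ n`.  One round of the tree's `sHop` law = STEP 1: blow up every crossing
curve of two alive neighbours `(a, b)` (newborn label `a + b − n`, inserted between them), then STEP 2: blow up (the strict
transform of) every old component (label `a ↦ a − n`; dead components are recorded as `a − n < n` / `0` separators and never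
move again).  DEFINITION (model of the tree's two-step `sHop` on monomial data; the dictionary is certified in §C). -/
def sRound (n : ℕ) : List ℕ → List ℕ
  | [] => []
  | [a] => [a - n]
  | a :: b :: t => if n ≤ a ∧ n ≤ b then (a - n) :: (a + b - n) :: sRound n (b :: t) else (a - n) :: sRound n (b :: t)

/-- `sRound_cons_cons`: NerveCut (lens-6 g31) helper; docstring added by the writer (lint.docstring) [folklore] -/
theorem sRound_cons_cons (n a b : ℕ) (t : List ℕ) :
    sRound n (a :: b :: t) = ((a - n) :: if n ≤ a ∧ n ≤ b then [a + b - n] else []) ++ sRound n (b :: t) := by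
  by_cases h : n ≤ a ∧ n ≤ b <;> simp [sRound, h]

/-- `sRound_cons_eq`: NerveCut (lens-6 g31) helper; docstring added by the writer (lint.docstring) [folklore] -/
theorem sRound_cons_eq (n b : ℕ) (t : List ℕ) : ∃ r, sRound n (b :: t) = (b - n) :: r := by
  cases t with
  | nil => exact ⟨[], rfl⟩
  | cons c t => rw [sRound_cons_cons]; exact ⟨_, rfl⟩

/-- `sRound_cons_append`: NerveCut (lens-6 g31) helper; docstring added by the writer (lint.docstring) [folklore] -/
theorem sRound_cons_append (n c : ℕ) {l : List ℕ} (hl : l ≠ []) : ∃ q, sRound n (c :: l) = q ++ sRound n l := by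
  obtain ⟨d, rest, rfl⟩ := List.exists_cons_of_ne_nil hl
  rw [sRound_cons_cons]; exact ⟨_, rfl⟩

/-- an alive adjacent pair `(a, b)` becomes the consecutive triple `(a − n, a + b − n, b − n)` after one round. [new] -/
theorem sRound_infix {n a b : ℕ} (ha : n ≤ a) (hb : n ≤ b) (pre post : List ℕ) :
    ∃ pre' post', sRound n (pre ++ a :: b :: post) = pre' ++ (a - n) :: (a + b - n) :: (b - n) :: post' := by
  induction pre with
  | nil =>
    obtain ⟨r, hr⟩ := sRound_cons_eq n b post
    refine ⟨[], r, ?_⟩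
    rw [List.nil_append, sRound_cons_cons, hr, if_pos ⟨ha, hb⟩]; rfl
  | cons c pre ih =>
    obtain ⟨pre', post', h⟩ := ih
    obtain ⟨q, hq⟩ := sRound_cons_append n c (l := pre ++ a :: b :: post) (by simp)
    refine ⟨q ++ pre', post', ?_⟩
    rw [List.cons_append, hq, h, List.append_assoc]

/-- **HEAVY EDGE** with witness `m`: two consecutive labels `(a, b)` with `a ≥ 3n, b ≥ 2n` (or mirrored) and `m ≤` the heavy
one. DEFINITION (the growth invariant). -/
def HeavyEdge (n m : ℕ) (l : List ℕ) : Prop :=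
  ∃ pre post a b, l = pre ++ a :: b :: post ∧ ((3 * n ≤ a ∧ 2 * n ≤ b ∧ m ≤ a) ∨ (2 * n ≤ a ∧ 3 * n ≤ b ∧ m ≤ b))

/-- **LIVE EDGE**: two consecutive labels `(a, b)` with `a ≥ 2n, b ≥ n` (or mirrored). DEFINITION (the perpetuity invariant). -/
def LiveEdge (n : ℕ) (l : List ℕ) : Prop :=
  ∃ pre post a b, l = pre ++ a :: b :: post ∧ ((2 * n ≤ a ∧ n ≤ b) ∨ (n ≤ a ∧ 2 * n ≤ b))

/-- **A HEAVY EDGE SURVIVES A ROUND AND ITS WITNESS GROWS BY `n`.** [new — the growth law] -/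
theorem heavyEdge_sRound {n m : ℕ} {l : List ℕ} (h : HeavyEdge n m l) : HeavyEdge n (m + n) (sRound n l) := by
  obtain ⟨pre, post, a, b, rfl, hab⟩ := h
  have ha : n ≤ a := by omega
  have hb : n ≤ b := by omega
  obtain ⟨pre', post', e⟩ := sRound_infix ha hb pre post
  rcases hab with ⟨h1, h2, h3⟩ | ⟨h1, h2, h3⟩
  · exact ⟨pre', (b - n) :: post', a - n, a + b - n, e, Or.inr ⟨by omega, by omega, by omega⟩⟩
  · refine ⟨pre' ++ [a - n], post', a + b - n, b - n, ?_, Or.inl ⟨by omega, by omega, by omega⟩⟩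
    rw [e]; simp

/-- **A LIVE EDGE SURVIVES A ROUND.** [new — the perpetuity law] -/
theorem liveEdge_sRound {n : ℕ} {l : List ℕ} (h : LiveEdge n l) : LiveEdge n (sRound n l) := by
  obtain ⟨pre, post, a, b, rfl, hab⟩ := h
  have ha : n ≤ a := by omega
  have hb : n ≤ b := by omega
  obtain ⟨pre', post', e⟩ := sRound_infix ha hb pre post
  rcases hab with ⟨h1, h2⟩ | ⟨h1, h2⟩
  · exact ⟨pre', (b - n) :: post', a - n, a + b - n, e, Or.inr ⟨by omega, by omega⟩⟩
  · refine ⟨pre' ++ [a - n], post', a + b - n, b - n, ?_, Or.inl ⟨by omega, by omega⟩⟩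
    rw [e]; simp

/-- `liveEdge_of_heavyEdge`: NerveCut (lens-6 g31) helper; docstring added by the writer (lint.docstring) [folklore] -/
theorem liveEdge_of_heavyEdge {n m : ℕ} {l : List ℕ} (h : HeavyEdge n m l) : LiveEdge n l := by
  obtain ⟨pre, post, a, b, rfl, hab⟩ := h
  exact ⟨pre, post, a, b, rfl, by omega⟩

/-- **GROWTH ALONG THE ITERATED ROUNDS**: a heavy edge with witness `m` persists with witness `m + i·n` after `i` rounds. [new] -/
theorem heavyEdge_iterate {n m : ℕ} {l : List ℕ} (h : HeavyEdge n m l) (i : ℕ) :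
    HeavyEdge n (m + i * n) ((sRound n)^[i] l) := by
  induction i with
  | zero => simpa using h
  | succ i ih =>
    rw [Function.iterate_succ_apply', show m + (i + 1) * n = m + i * n + n by ring]
    exact heavyEdge_sRound ih

/-- **PERPETUITY ALONG THE ITERATED ROUNDS**: a live edge is never lost — at every round two consecutive ALIVE components
(labels `≥ n`) remain, so the bad locus is never empty and the law always has a next move. [new] -/
theorem liveEdge_iterate {n : ℕ} {l : List ℕ} (h : LiveEdge n l) (i : ℕ) : LiveEdge n ((sRound n)^[i] l) := by
  induction i with
  | zero => simpa using h
  | succ i ih => rw [Function.iterate_succ_apply']; exact liveEdge_sRound ih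

/-- `exists_alive_pair_of_liveEdge`: NerveCut (lens-6 g31) helper; docstring added by the writer (lint.docstring) [folklore] -/
theorem exists_alive_pair_of_liveEdge {n : ℕ} {l : List ℕ} (h : LiveEdge n l) :
    ∃ pre post a b, l = pre ++ a :: b :: post ∧ n ≤ a ∧ n ≤ b := by
  obtain ⟨pre, post, a, b, rfl, hab⟩ := h
  exact ⟨pre, post, a, b, rfl, by omega, by omega⟩

/-- **UNBOUNDED LABELS**: under a heavy edge the maximal label after `i` rounds is at least `m + i·n` — NO function of the
labels bounded along the play can be a termination measure for the crossing-first law. [new — kills «P‴ invariant WHOLE»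
and every label-bounded recurrence bound for this law] -/
theorem heavyEdge_unbounded {n m : ℕ} {l : List ℕ} (h : HeavyEdge n m l) (i : ℕ) :
    ∃ a ∈ (sRound n)^[i] l, m + i * n ≤ a := by
  obtain ⟨pre, post, a, b, e, hab⟩ := heavyEdge_iterate h i
  rcases hab with ⟨-, -, h3⟩ | ⟨-, -, h3⟩
  · exact ⟨a, by rw [e]; simp, h3⟩
  · exact ⟨b, by rw [e]; simp, h3⟩

/-! ### The datum D₀ = (x², z⁶w⁶), n = 2: labels [6, 6] -/

/-- `D₀`'s string carries a heavy edge with witness `6`. -/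
theorem D0_heavyEdge : HeavyEdge 2 6 [6, 6] := ⟨[], [], 6, 6, rfl, Or.inl ⟨by norm_num, by norm_num, le_rfl⟩⟩

/-- hence the crossing-first play from `D₀` never runs out of alive crossings … -/
theorem D0_live_forever (i : ℕ) : LiveEdge 2 ((sRound 2)^[i] [6, 6]) :=
  liveEdge_iterate (liveEdge_of_heavyEdge D0_heavyEdge) i

/-- … and its labels exceed every bound: after `i` rounds some label is `≥ 6 + 2i`. -/
theorem D0_unbounded (i : ℕ) : ∃ a ∈ (sRound 2)^[i] [6, 6], 6 + i * 2 ≤ a := heavyEdge_unbounded D0_heavyEdge i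

/-- **NO TERMINATION MEASURE FOR THE CROSSING-FIRST LAW (the «P‴ invariant WHOLE» door, list level).**  There is NO map `μ`
from label strings to ANY well-founded order that drops along one crossing-first round on every string with a live edge —
the rounds from `[2n, n]` run for ever inside the live-edge class.  (For `n ≥ 1` and the tree's `sHop` this is the statement
that no well-founded quantity decreases on every S-move of every base datum: the door «P‴ invariant WHOLE» is closed for
cause, not for want of an idea.) [new] -/
theorem no_termination_measure (n : ℕ) {α : Type*} (r : α → α → Prop) (hwf : WellFounded r) (μ : List ℕ → α) :
    ¬ ∀ l, LiveEdge n l → r (μ (sRound n l)) (μ l) := by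
  intro h
  have h0 : LiveEdge n [2 * n, n] := ⟨[], [], 2 * n, n, rfl, Or.inl ⟨le_rfl, le_rfl⟩⟩
  obtain ⟨x, ⟨i, rfl⟩, hmin⟩ :=
    hwf.has_min (Set.range fun i => μ ((sRound n)^[i] [2 * n, n])) ⟨_, 0, rfl⟩
  refine hmin (μ ((sRound n)^[i + 1] [2 * n, n])) ⟨i + 1, rfl⟩ ?_
  rw [Function.iterate_succ_apply']
  exact h _ (liveEdge_iterate h0 i)

/-- the first rounds, matching the desk chain of `frame/CN37.md` (g30) label for label (`0` = dead separator):
`[6,6] → [4,10,4] → [2,12,8,12,2] → [0,12,10,18,6,18,10,12,0] → (max 26) → (max 40)`. -/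
theorem D0_rounds :
    sRound 2 [6, 6] = [4, 10, 4] ∧ sRound 2 [4, 10, 4] = [2, 12, 8, 12, 2] ∧
    sRound 2 [2, 12, 8, 12, 2] = [0, 12, 10, 18, 6, 18, 10, 12, 0] ∧
    ((sRound 2)^[4] [6, 6]).maximum = some 26 ∧ ((sRound 2)^[5] [6, 6]).maximum = some 40 := by
  refine ⟨by decide, by decide, by decide, by decide, by decide⟩

/-- **THE BOUNDED PERPETUAL ORBIT** `(4,2) ↔ (2,4)` = the s-run of D₁ = `(x², z⁴w²)` in characteristic 2 (n.c. from the start;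
same dictionary as D₀): labels stay bounded, the live edge alternates for ever — an S-perpetual datum with STATIONARY
invariant profile (`max label = 4` at every level). -/
theorem periodic_orbit : sRound 2 [4, 2] = [2, 4, 0] ∧ sRound 2 [2, 4, 0] = [0, 4, 2, 0] ∧
    sRound 2 [0, 4, 2, 0] = [0, 2, 4, 0, 0] ∧ LiveEdge 2 [4, 2] := by
  refine ⟨by decide, by decide, by decide, [], [], 4, 2, rfl, Or.inl ⟨le_rfl, le_rfl⟩⟩

end SRound

end CrossingRound

end Summit.ResolutionOfSingularities.ResolutionOfSingularities.Theorems.DeltaCutClasses
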